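import Summits.QuantumFields.YangMills.Theorems.PoincareLipschitzWeakChainRuleShear
import Summits.QuantumFields.YangMills.Theorems.PoincareLipschitzAxialStationarityLetters
import HarnessLib

/-!
# Crux `BlockLipschitzL` (stmt-QuantumFields-23533) ∕ `HistoryTailL` (stmt-QuantumFields-19936), LINE 25 «CompactnessTransfer»,
# stub S1″ row (M) «MONOTONICITY» — FILE γ «AXIAL STATIONARITY OF BALL MINIMISERS»

Cell `ym3-torus` (YM ladder rung R3 = continuum SU(2) Yang–Mills on T³ — a RUNG, NOT the Clay problem: not d = 4, not
infinite volume, not a mass gap); WIDTH helper seat `ym-ust-19936-w2` g13.  Helper `--supports stmt-QuantumFields-19936`;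
THEOREMS ONLY (0 `def`, 0 `sorry`, default heartbeats); imports: FILE β ✓`PoincareLipschitzWeakChainRuleShear` (weak chain rule
for `U ∘ Φ`; through it FILE α ✓`PoincareLipschitzAxialShear` and lit ✓`SobolevDomain`), FILE γ-letters
✓`PoincareLipschitzAxialStationarityLetters` (transported density algebra, integrability of the density pieces).

WHAT THIS FILE DOES.  For a finite-energy unit `W^{1,2}` map `U` (weak gradient `G`, lit `HasWeakFDerivOn Ω volume U G`)
on an open `Ω ⊆ ℝ³` which minimises the Dirichlet energy `∫ Σ_i ‖G e_i‖²` on a ball `B_ρ(y)`, `B̄_ρ(y) ⊆ Ω`, among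
finite-energy unit `W^{1,2}(Ω)` competitors agreeing with `U` off a smaller concentric ball (the minimality notion of
[Simon1996, §2.1] in Sobolev phrasing — w3 g15's `hMono`∕`hCpt`∕`hReg` rows), the FIRST INNER VARIATION along each
coordinate axis vanishes (★★★ `axial_stationarity`): for every `f ∈ C^∞` with `tsupport f ⊆ B_{ρ′}(y)`, `ρ′ < ρ`, and
every axis `k`,
`∫_{B_ρ(y)} ( Σ_i 2·∂_if·⟪G e_i, G e_k⟫ − ∂_kf · Σ_i ‖G e_i‖² ) = 0`.
Proof WITHOUT differentiating under the integral: the competitor `U ∘ Φ_t` for the axial shear `z ↦ z − t f(z)•e_k`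
(FILES α∕β) has transported density EXACTLY `Σ_i [(1 − t∂_kf)‖Ge_i‖² + 2t∂_if⟪Ge_i,Ge_k⟫ + t²(∂_if)²‖Ge_k‖²∕(1 − t∂_kf)]`
(γ-letters ★ `jacobian_mul_transportedDensity`), so `E(t) − E(0) = t·I₁ + t²·r(t)` with `|r(t)| ≤ C`; minimality for both
signs of small `t` forces `I₁ = 0`.

HONEST SCOPE.  Calculus of variations (inner variations) for Sobolev maps; (M) itself is FILE δ; nothing of (M), (C), (R),
S1″, S2♭″, `hHalvingBand`, K1, `MeanDeviationL`, `BlockLipschitzL`, `HistoryTailL` is proved here.  YM₃ on T³ is rung R3, not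
Clay; YM gap NOT proved; no summit statement is proved here.

References: L. Simon, Theorems on Regularity and Singularity of Energy Minimizing Maps (1996) [Simon1996] (§2.2 (v),
§2.4: minimisers are stationary under domain variations); P. Price, Manuscripta Math. 43 (1983) 131–166 [Price1983];
R. Schoen, K. Uhlenbeck, J. Differential Geom. 17 (1982) 307–335 [SchoenUhlenbeck1982] (§2).
-/

set_option autoImplicit false

noncomputable section

open MeasureTheory Set Function Filter Topology Metric TopologicalSpace
open scoped ContDiff RealInnerProductSpace BigOperators

namespace Summit.QuantumFields.YangMills.Theorems.PoincareLipschitzAxialStationarity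

open Literature.Analysis.FunctionSpaces (IsTestFunctionOn HasWeakFDerivOn)
open Summit.QuantumFields.YangMills.Theorems.PoincareLipschitzAxialShear
open Summit.QuantumFields.YangMills.Theorems.PoincareLipschitzWeakChainRuleShear
open Summit.QuantumFields.YangMills.Theorems.PoincareLipschitzAxialStationarityLetters

variable {F : Type*} [NormedAddCommGroup F] [InnerProductSpace ℝ F]

/-! ## §3 The transported competitor -/

/-- ★★ **THE AXIAL COMPETITOR.**  Data: `U` weakly differentiable on the open `Ω ⊆ ℝ³` with weak gradient `G`, unit on `Ω`,
finite energy on `Ω`; `h ∈ C^∞` with compact support in `Ω` and `‖Dh‖ ≤ L < 1`; an axis `k`.  Then there is a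
competitor `W` with weak gradient `GW` on `Ω`, unit on `Ω`, of finite energy on `Ω`, equal to `U` off `tsupport h`, whose
energy on every measurable `S` with `tsupport h ⊆ S ⊆ Ω` is the integral of the transported density
`Σ_i [(1 − ∂_kh)‖Ge_i‖² + 2∂_ih⟪Ge_i,Ge_k⟫ + (∂_ih)²‖Ge_k‖²∕(1 − ∂_kh)]` (it is `U ∘ Φ` for the inverse `Φ` of the shear
`z ↦ z − h z • e_k`, FILES α∕β). [cite: Simon1996, §2.2 (v)] -/
theorem exists_axial_competitor {Ω : Opens (EuclideanSpace ℝ (Fin 3))}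
    {U : EuclideanSpace ℝ (Fin 3) → F} {G : EuclideanSpace ℝ (Fin 3) → EuclideanSpace ℝ (Fin 3) →L[ℝ] F}
    (hU : HasWeakFDerivOn Ω volume U G) (hU1 : ∀ x ∈ (Ω : Set (EuclideanSpace ℝ (Fin 3))), ‖U x‖ = 1)
    (hGi : IntegrableOn (fun x => ∑ i : Fin 3, ‖G x (EuclideanSpace.single i (1:ℝ))‖ ^ 2) (Ω : Set _) volume)
    {h : EuclideanSpace ℝ (Fin 3) → ℝ} (hh : ContDiff ℝ ∞ h) (hsupp : HasCompactSupport h)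
    (hΩ : tsupport h ⊆ (Ω : Set _)) {L : ℝ} (hL : ∀ z, ‖fderiv ℝ h z‖ ≤ L) (hL1 : L < 1) (k : Fin 3) :
    ∃ (W : EuclideanSpace ℝ (Fin 3) → F) (GW : EuclideanSpace ℝ (Fin 3) → EuclideanSpace ℝ (Fin 3) →L[ℝ] F),
      HasWeakFDerivOn Ω volume W GW ∧
      (∀ x ∈ (Ω : Set (EuclideanSpace ℝ (Fin 3))), ‖W x‖ = 1) ∧
      IntegrableOn (fun x => ∑ i : Fin 3, ‖GW x (EuclideanSpace.single i (1:ℝ))‖ ^ 2) (Ω : Set _) volume ∧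
      (∀ x, x ∉ tsupport h → W x = U x) ∧
      ∀ S : Set (EuclideanSpace ℝ (Fin 3)), MeasurableSet S → tsupport h ⊆ S → S ⊆ (Ω : Set _) →
        ∫ x in S, ∑ i : Fin 3, ‖GW x (EuclideanSpace.single i (1:ℝ))‖ ^ 2 =
          ∫ z in S, ∑ i : Fin 3, ((1 - fderiv ℝ h z (EuclideanSpace.single k (1:ℝ))) *
              ‖G z (EuclideanSpace.single i (1:ℝ))‖ ^ 2 +
            2 * fderiv ℝ h z (EuclideanSpace.single i (1:ℝ)) *
              ⟪G z (EuclideanSpace.single i (1:ℝ)), G z (EuclideanSpace.single k (1:ℝ))⟫ +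
            fderiv ℝ h z (EuclideanSpace.single i (1:ℝ)) ^ 2 / (1 - fderiv ℝ h z (EuclideanSpace.single k (1:ℝ))) *
              ‖G z (EuclideanSpace.single k (1:ℝ))‖ ^ 2) := by
  -- the shear data
  have he : ‖(EuclideanSpace.single k (1:ℝ) : EuclideanSpace ℝ (Fin 3))‖ ≤ 1 := (norm_single_one k).le
  have hhd : Differentiable ℝ h := hh.differentiable (by simp)
  have hL0 : 0 ≤ L := (norm_nonneg _).trans (hL 0)
  haveI : CompleteSpace (EuclideanSpace ℝ (Fin 3)) := FiniteDimensional.complete ℝ _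
  obtain ⟨Φ, hΦl, hΦr⟩ := exists_inverse (e := EuclideanSpace.single k (1:ℝ)) hhd hL he hL0 hL1
  have hne : ∀ z, fderiv ℝ h z (EuclideanSpace.single k (1:ℝ)) ≠ 1 := fun z => fderiv_apply_ne_one (hL z) he hL1
  have hJpos : ∀ z, 0 < 1 - fderiv ℝ h z (EuclideanSpace.single k (1:ℝ)) := fun z => one_sub_fderiv_pos (hL z) he hL1
  have hΩm : MeasurableSet (Ω : Set (EuclideanSpace ℝ (Fin 3))) := Ω.isOpen.measurableSet
  -- the competitor and its weak gradient (FILE β)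
  have hW := hasWeakFDerivOn_comp_inverse (μ := volume) hh hsupp hΩ hL he hL1 hΦl hΦr hU
  refine ⟨fun x => U (Φ x), _, hW, ?_, ?_, ?_, ?_⟩
  · exact forall_comp_inverse_of_forall hΦl hΦr hΩ U (p := fun v => ‖v‖ = 1) hU1
  · -- finite energy on `Ω`: transport and compare with the transported density
    have hGm : AEStronglyMeasurable G (volume.restrict (Ω : Set _)) := hU.locallyIntegrableOn_deriv.aestronglyMeasurable
    rw [integrableOn_comp_inverse_iff volume hhd hL he hL1 hΦl hΩm hΩ
      (fun z => ∑ i : Fin 3, ‖((G z).comp (ContinuousLinearMap.id ℝ (EuclideanSpace ℝ (Fin 3)) +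
        (1 - fderiv ℝ h z (EuclideanSpace.single k (1:ℝ)))⁻¹ • (fderiv ℝ h z).smulRight (EuclideanSpace.single k (1:ℝ))))
        (EuclideanSpace.single i (1:ℝ))‖ ^ 2)]
    have heq : ∀ z, (1 - fderiv ℝ h z (EuclideanSpace.single k (1:ℝ))) •
        (∑ i : Fin 3, ‖((G z).comp (ContinuousLinearMap.id ℝ (EuclideanSpace ℝ (Fin 3)) +
          (1 - fderiv ℝ h z (EuclideanSpace.single k (1:ℝ)))⁻¹ • (fderiv ℝ h z).smulRight (EuclideanSpace.single k (1:ℝ))))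
          (EuclideanSpace.single i (1:ℝ))‖ ^ 2) =
        ∑ i : Fin 3, ((1 - fderiv ℝ h z (EuclideanSpace.single k (1:ℝ))) * ‖G z (EuclideanSpace.single i (1:ℝ))‖ ^ 2 +
          2 * fderiv ℝ h z (EuclideanSpace.single i (1:ℝ)) *
            ⟪G z (EuclideanSpace.single i (1:ℝ)), G z (EuclideanSpace.single k (1:ℝ))⟫ +
          fderiv ℝ h z (EuclideanSpace.single i (1:ℝ)) ^ 2 / (1 - fderiv ℝ h z (EuclideanSpace.single k (1:ℝ))) *
            ‖G z (EuclideanSpace.single k (1:ℝ))‖ ^ 2) := by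
      intro z
      rw [smul_eq_mul]
      simp only [ContinuousLinearMap.comp_apply]
      exact jacobian_mul_transportedDensity (G z) (fderiv ℝ h z) k (hne z)
    simp_rw [heq]
    -- integrability of the three pieces
    refine integrable_finsetSum _ fun i _ => ?_
    refine ((?_ : IntegrableOn _ _ _).add ?_).add ?_
    · exact integrableOn_continuous_mul (contDiff_jacobian hh).continuous (C := 1 + L)
        (fun x => by
          have h1 : |fderiv ℝ h x (EuclideanSpace.single k (1:ℝ))| ≤ L := abs_apply_single_le (hL x) k
          have := abs_sub (1 : ℝ) (fderiv ℝ h x (EuclideanSpace.single k (1:ℝ)))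
          rw [abs_one] at this
          linarith)
        (integrableOn_norm_sq_apply hGm hGi i)
    · have hc : Continuous fun x => 2 * fderiv ℝ h x (EuclideanSpace.single i (1:ℝ)) :=
        continuous_const.mul (contDiff_fderiv_apply hh _).continuous
      have := integrableOn_continuous_mul hc (C := 2 * L)
        (fun x => by
          have h1 : |fderiv ℝ h x (EuclideanSpace.single i (1:ℝ))| ≤ L := abs_apply_single_le (hL x) i
          rw [abs_mul, abs_two]
          linarith)
        (integrableOn_inner_apply hGm hGi i k)
      simpa only [mul_assoc] using this
    · have hc : Continuous fun x => fderiv ℝ h x (EuclideanSpace.single i (1:ℝ)) ^ 2 /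
          (1 - fderiv ℝ h x (EuclideanSpace.single k (1:ℝ))) :=
        ((contDiff_fderiv_apply hh _).continuous.pow 2).div (contDiff_jacobian hh).continuous
          (fun x => (hJpos x).ne')
      exact integrableOn_continuous_mul hc (C := L ^ 2 / (1 - L))
        (fun x => by
          have h1 : |fderiv ℝ h x (EuclideanSpace.single i (1:ℝ))| ≤ L := abs_apply_single_le (hL x) i
          have h2 : |fderiv ℝ h x (EuclideanSpace.single k (1:ℝ))| ≤ L := abs_apply_single_le (hL x) k
          have hJ := hJpos x
          rw [abs_div, abs_of_pos hJ, div_le_div_iff₀ hJ (by linarith)]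
          have h3 : fderiv ℝ h x (EuclideanSpace.single i (1:ℝ)) ^ 2 ≤ L ^ 2 := by
            rw [← sq_abs]; exact pow_le_pow_left₀ (abs_nonneg _) h1 2
          rw [abs_of_nonneg (sq_nonneg _)]
          have h4 : 1 - L ≤ 1 - fderiv ℝ h x (EuclideanSpace.single k (1:ℝ)) := by linarith [(abs_le.mp h2).2]
          exact mul_le_mul h3 h4 (by linarith) (sq_nonneg _))
        (integrableOn_norm_sq_apply hGm hGi k)
  · intro x hx
    exact comp_inverse_eq_of_notMem hΦl U hx
  · intro S hSm hhS hSΩ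
    rw [setIntegral_comp_inverse_eq volume hhd hL he hL1 hΦl hSm hhS
      (fun z => ∑ i : Fin 3, ‖((G z).comp (ContinuousLinearMap.id ℝ (EuclideanSpace ℝ (Fin 3)) +
        (1 - fderiv ℝ h z (EuclideanSpace.single k (1:ℝ)))⁻¹ • (fderiv ℝ h z).smulRight (EuclideanSpace.single k (1:ℝ))))
        (EuclideanSpace.single i (1:ℝ))‖ ^ 2)]
    refine setIntegral_congr_fun hSm fun z _ => ?_
    rw [smul_eq_mul]
    simp only [ContinuousLinearMap.comp_apply]
    exact jacobian_mul_transportedDensity (G z) (fderiv ℝ h z) k (hne z)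

/-! ## §4 Axial stationarity -/

/-- **Elementary**: if `t·I + t²·C ≥ 0` for all `t ∈ [−t₀, t₀]` (`t₀ > 0`, `C ≥ 0`), then `I = 0`. [folklore] -/
theorem eq_zero_of_quadratic_nonneg {I C t₀ : ℝ} (ht₀ : 0 < t₀) (hC : 0 ≤ C)
    (h : ∀ t : ℝ, |t| ≤ t₀ → 0 ≤ t * I + t ^ 2 * C) : I = 0 := by
  by_contra hI
  rcases lt_or_gt_of_ne hI with hneg | hpos
  · -- I < 0: take t > 0 small
    set t := min t₀ (-I / (2 * (C + 1))) with ht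
    have htpos : 0 < t := lt_min ht₀ (div_pos (by linarith) (by linarith))
    have ht1 : t ≤ t₀ := min_le_left _ _
    have ht2 : t ≤ -I / (2 * (C + 1)) := min_le_right _ _
    have h1 := h t (by rw [abs_of_pos htpos]; exact ht1)
    have h3 : t * (2 * (C + 1)) ≤ -I := (le_div_iff₀ (by linarith)).mp ht2
    have h4 : t ^ 2 * C ≤ t * (t * (C + 1)) := by nlinarith
    nlinarith
  · -- I > 0: take t < 0 small
    set t := min t₀ (I / (2 * (C + 1))) with ht
    have htpos : 0 < t := lt_min ht₀ (div_pos hpos (by linarith))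
    have ht1 : t ≤ t₀ := min_le_left _ _
    have ht2 : t ≤ I / (2 * (C + 1)) := min_le_right _ _
    have h1 := h (-t) (by rw [abs_neg, abs_of_pos htpos]; exact ht1)
    have h3 : t * (2 * (C + 1)) ≤ I := (le_div_iff₀ (by linarith)).mp ht2
    have h4 : t ^ 2 * C ≤ t * (t * (C + 1)) := by nlinarith
    nlinarith

/-- ★★★ **AXIAL STATIONARITY OF BALL MINIMISERS.**  Let `U` be weakly differentiable on the open `Ω ⊆ ℝ³` with weak
gradient `G` (lit `HasWeakFDerivOn Ω volume U G`), unit on `Ω`, of finite energy `∫_Ω Σ_i‖G e_i‖² < ∞`, and energy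
minimising on the ball `B_ρ(y) ⊆ Ω` among finite-energy unit `W^{1,2}(Ω)` competitors that agree with `U` off some
`B_{ρ″}(y)`, `ρ″ < ρ` ([Simon1996, §2.1] in Sobolev phrasing).  Then for every `f ∈ C^∞` with `tsupport f ⊆ B_{ρ′}(y)`,
`ρ′ < ρ`, and every coordinate axis `k`:
`∫_{B_ρ(y)} ( Σ_i 2·∂_if·⟪G e_i, G e_k⟫ − ∂_kf · Σ_i‖G e_i‖² ) = 0` — the first inner variation in the direction of
the axial field `f·e_k` vanishes.  Proof: FILE γ §3 competitor for `h := t·f`, exact quadratic expansion in `t`,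
minimality for `t` of both signs. [cite: Simon1996, §2.2 (v), §2.4; Price1983, §1] -/
theorem axial_stationarity {Ω : Opens (EuclideanSpace ℝ (Fin 3))}
    {U : EuclideanSpace ℝ (Fin 3) → F} {G : EuclideanSpace ℝ (Fin 3) → EuclideanSpace ℝ (Fin 3) →L[ℝ] F}
    (hU : HasWeakFDerivOn Ω volume U G) (hU1 : ∀ x ∈ (Ω : Set (EuclideanSpace ℝ (Fin 3))), ‖U x‖ = 1)
    (hGi : IntegrableOn (fun x => ∑ i : Fin 3, ‖G x (EuclideanSpace.single i (1:ℝ))‖ ^ 2) (Ω : Set _) volume)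
    {y : EuclideanSpace ℝ (Fin 3)} {ρ ρ' : ℝ} (hρ' : ρ' < ρ) (hB : ball y ρ ⊆ (Ω : Set _))
    (hmin : ∀ (W : EuclideanSpace ℝ (Fin 3) → F) (GW : EuclideanSpace ℝ (Fin 3) → EuclideanSpace ℝ (Fin 3) →L[ℝ] F),
      HasWeakFDerivOn Ω volume W GW → (∀ x ∈ (Ω : Set (EuclideanSpace ℝ (Fin 3))), ‖W x‖ = 1) →
      IntegrableOn (fun x => ∑ i : Fin 3, ‖GW x (EuclideanSpace.single i (1:ℝ))‖ ^ 2) (Ω : Set _) volume →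
      (∃ ρ'' : ℝ, ρ'' < ρ ∧ ∀ x, x ∉ ball y ρ'' → W x = U x) →
      ∫ x in ball y ρ, ∑ i : Fin 3, ‖G x (EuclideanSpace.single i (1:ℝ))‖ ^ 2 ≤
        ∫ x in ball y ρ, ∑ i : Fin 3, ‖GW x (EuclideanSpace.single i (1:ℝ))‖ ^ 2)
    {f : EuclideanSpace ℝ (Fin 3) → ℝ} (hf : ContDiff ℝ ∞ f) (hfs : tsupport f ⊆ ball y ρ') (k : Fin 3) :
    ∫ x in ball y ρ, (∑ i : Fin 3, 2 * fderiv ℝ f x (EuclideanSpace.single i (1:ℝ)) *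
        ⟪G x (EuclideanSpace.single i (1:ℝ)), G x (EuclideanSpace.single k (1:ℝ))⟫ -
      fderiv ℝ f x (EuclideanSpace.single k (1:ℝ)) * ∑ i : Fin 3, ‖G x (EuclideanSpace.single i (1:ℝ))‖ ^ 2) = 0 := by
  -- geometry of the supports
  have hρ'B : ball y ρ' ⊆ ball y ρ := ball_subset_ball hρ'.le
  have hfB : tsupport f ⊆ ball y ρ := hfs.trans hρ'B
  have hfΩ : tsupport f ⊆ (Ω : Set _) := hfB.trans hB
  have hfc : HasCompactSupport f :=
    IsCompact.of_isClosed_subset (isCompact_closedBall y ρ') (isClosed_tsupport f) (hfs.trans ball_subset_closedBall)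
  have hBm : MeasurableSet (ball y ρ) := measurableSet_ball
  -- a bound on the gradient of `f`
  have hfd : Differentiable ℝ f := hf.differentiable (by simp)
  have hf'c : Continuous (fderiv ℝ f) := hf.continuous_fderiv (by simp)
  obtain ⟨M, hM⟩ := (hfc.fderiv (𝕜 := ℝ)).exists_bound_of_continuous hf'c
  have hM0 : 0 ≤ M := (norm_nonneg _).trans (hM y)
  -- the density pieces are integrable on the ball
  have hGm : AEStronglyMeasurable G (volume.restrict (Ω : Set _)) := hU.locallyIntegrableOn_deriv.aestronglyMeasurable
  have hGmB : AEStronglyMeasurable G (volume.restrict (ball y ρ)) := hGm.mono_set hB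
  have hGiB : IntegrableOn (fun x => ∑ i : Fin 3, ‖G x (EuclideanSpace.single i (1:ℝ))‖ ^ 2) (ball y ρ) volume :=
    hGi.mono_set hB
  have Isq : ∀ j, IntegrableOn (fun x => ‖G x (EuclideanSpace.single j (1:ℝ))‖ ^ 2) (ball y ρ) volume :=
    fun j => integrableOn_norm_sq_apply hGmB hGiB j
  -- abbreviations for the three integrals
  set E₀ : ℝ := ∫ x in ball y ρ, ∑ i : Fin 3, ‖G x (EuclideanSpace.single i (1:ℝ))‖ ^ 2 with hE₀
  set I₁ : ℝ := ∫ x in ball y ρ, (∑ i : Fin 3, 2 * fderiv ℝ f x (EuclideanSpace.single i (1:ℝ)) *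
        ⟪G x (EuclideanSpace.single i (1:ℝ)), G x (EuclideanSpace.single k (1:ℝ))⟫ -
      fderiv ℝ f x (EuclideanSpace.single k (1:ℝ)) * ∑ i : Fin 3, ‖G x (EuclideanSpace.single i (1:ℝ))‖ ^ 2) with hI₁
  set C : ℝ := 6 * M ^ 2 * ∫ x in ball y ρ, ‖G x (EuclideanSpace.single k (1:ℝ))‖ ^ 2 with hC
  have hC0 : 0 ≤ C := by positivity
  -- the main estimate: for |t| ≤ 1/(2M+2), minimality gives `0 ≤ t I₁ + t² C`
  refine eq_zero_of_quadratic_nonneg (t₀ := 1 / (2 * M + 2)) (by positivity) hC0 fun t ht => ?_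
  -- the shear data for `h := t • f`
  have htM : |t| * M ≤ 1 / 2 := by
    have : |t| * M ≤ 1 / (2 * M + 2) * M := mul_le_mul_of_nonneg_right ht hM0
    refine this.trans ?_
    rw [div_mul_eq_mul_div, one_mul, div_le_iff₀ (by positivity)]
    linarith
  have hh : ContDiff ℝ ∞ (fun z => t * f z) := contDiff_const.mul hf
  have hhs : tsupport (fun z => t * f z) ⊆ tsupport f := by
    have : tsupport ((fun _ => t) * f) ⊆ tsupport f := tsupport_mul_subset_right
    exact this
  have hhc : HasCompactSupport (fun z => t * f z) := by
    have : HasCompactSupport ((fun _ : EuclideanSpace ℝ (Fin 3) => t) * f) := hfc.mul_left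
    exact this
  have hfderiv_h : ∀ z, fderiv ℝ (fun z => t * f z) z = t • fderiv ℝ f z := fun z => fderiv_const_mul (hfd z) t
  have hL : ∀ z, ‖fderiv ℝ (fun z => t * f z) z‖ ≤ 1 / 2 := fun z => by
    rw [hfderiv_h z, norm_smul, Real.norm_eq_abs]
    exact (mul_le_mul_of_nonneg_left (hM z) (abs_nonneg t)).trans htM
  obtain ⟨W, GW, hW, hW1, hWi, hWU, hWE⟩ := exists_axial_competitor hU hU1 hGi hh hhc (hhs.trans hfΩ) hL
    (by norm_num) k
  -- minimality applied to the competitor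
  have hminW := hmin W GW hW hW1 hWi ⟨ρ', hρ', fun x hx => hWU x (fun hx' => hx (hfs (hhs hx')))⟩
  rw [hWE (ball y ρ) hBm (hhs.trans hfB) hB] at hminW
  -- expand the transported density in powers of `t`
  have hJpos : ∀ z, 0 < 1 - t * fderiv ℝ f z (EuclideanSpace.single k (1:ℝ)) := fun z => by
    have h1 : |t * fderiv ℝ f z (EuclideanSpace.single k (1:ℝ))| ≤ 1 / 2 := by
      rw [abs_mul]
      have h2 : |fderiv ℝ f z (EuclideanSpace.single k (1:ℝ))| ≤ M := abs_apply_single_le (hM z) k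
      exact (mul_le_mul_of_nonneg_left h2 (abs_nonneg t)).trans htM
    linarith [(abs_le.mp h1).2]
  have hexp : ∀ z, ∑ i : Fin 3, ((1 - fderiv ℝ (fun z => t * f z) z (EuclideanSpace.single k (1:ℝ))) *
        ‖G z (EuclideanSpace.single i (1:ℝ))‖ ^ 2 +
      2 * fderiv ℝ (fun z => t * f z) z (EuclideanSpace.single i (1:ℝ)) *
        ⟪G z (EuclideanSpace.single i (1:ℝ)), G z (EuclideanSpace.single k (1:ℝ))⟫ +
      fderiv ℝ (fun z => t * f z) z (EuclideanSpace.single i (1:ℝ)) ^ 2 /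
        (1 - fderiv ℝ (fun z => t * f z) z (EuclideanSpace.single k (1:ℝ))) * ‖G z (EuclideanSpace.single k (1:ℝ))‖ ^ 2) =
      (∑ i : Fin 3, ‖G z (EuclideanSpace.single i (1:ℝ))‖ ^ 2) +
      t * (∑ i : Fin 3, 2 * fderiv ℝ f z (EuclideanSpace.single i (1:ℝ)) *
          ⟪G z (EuclideanSpace.single i (1:ℝ)), G z (EuclideanSpace.single k (1:ℝ))⟫ -
        fderiv ℝ f z (EuclideanSpace.single k (1:ℝ)) * ∑ i : Fin 3, ‖G z (EuclideanSpace.single i (1:ℝ))‖ ^ 2) +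
      t ^ 2 * ((∑ i : Fin 3, fderiv ℝ f z (EuclideanSpace.single i (1:ℝ)) ^ 2) /
          (1 - t * fderiv ℝ f z (EuclideanSpace.single k (1:ℝ))) * ‖G z (EuclideanSpace.single k (1:ℝ))‖ ^ 2) := by
    intro z
    simp only [hfderiv_h z, FunLike.coe_smul, Pi.smul_apply, smul_eq_mul]
    have hJ := (hJpos z).ne'
    simp only [Finset.sum_add_distrib, Fin.sum_univ_three]
    field_simp
    ring
  simp_rw [hexp] at hminW
  -- integrability of the three pieces on the ball, and the split of the integral
  have If' : ∀ j, Continuous fun z => fderiv ℝ f z (EuclideanSpace.single j (1:ℝ)) :=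
    fun j => hf'c.clm_apply continuous_const
  have hfj : ∀ j z, |fderiv ℝ f z (EuclideanSpace.single j (1:ℝ))| ≤ M := fun j z => abs_apply_single_le (hM z) j
  have II₁ : IntegrableOn (fun z => (∑ i : Fin 3, 2 * fderiv ℝ f z (EuclideanSpace.single i (1:ℝ)) *
          ⟪G z (EuclideanSpace.single i (1:ℝ)), G z (EuclideanSpace.single k (1:ℝ))⟫) -
        fderiv ℝ f z (EuclideanSpace.single k (1:ℝ)) * ∑ i : Fin 3, ‖G z (EuclideanSpace.single i (1:ℝ))‖ ^ 2)
      (ball y ρ) volume := integrableOn_firstVariation hGmB hGiB hf'c hM k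
  have IR : IntegrableOn (fun z => (∑ i : Fin 3, fderiv ℝ f z (EuclideanSpace.single i (1:ℝ)) ^ 2) /
        (1 - t * fderiv ℝ f z (EuclideanSpace.single k (1:ℝ))) * ‖G z (EuclideanSpace.single k (1:ℝ))‖ ^ 2)
      (ball y ρ) volume := by
    have hc : Continuous fun z => (∑ i : Fin 3, fderiv ℝ f z (EuclideanSpace.single i (1:ℝ)) ^ 2) /
        (1 - t * fderiv ℝ f z (EuclideanSpace.single k (1:ℝ))) :=
      (continuous_finsetSum _ fun i _ => (If' i).pow 2).div (continuous_const.sub (continuous_const.mul (If' k)))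
        fun z => (hJpos z).ne'
    refine integrableOn_continuous_mul hc (C := 6 * M ^ 2) (fun z => ?_) (Isq k)
    have hJ := hJpos z
    have hJ2 : 1 / 2 ≤ 1 - t * fderiv ℝ f z (EuclideanSpace.single k (1:ℝ)) := by
      have h1 : |t * fderiv ℝ f z (EuclideanSpace.single k (1:ℝ))| ≤ 1 / 2 := by
        rw [abs_mul]; exact (mul_le_mul_of_nonneg_left (hfj k z) (abs_nonneg t)).trans htM
      linarith [(abs_le.mp h1).2]
    have hnum : (∑ i : Fin 3, fderiv ℝ f z (EuclideanSpace.single i (1:ℝ)) ^ 2) ≤ 3 * M ^ 2 := by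
      have : ∀ i : Fin 3, fderiv ℝ f z (EuclideanSpace.single i (1:ℝ)) ^ 2 ≤ M ^ 2 := fun i => by
        rw [← sq_abs]; exact pow_le_pow_left₀ (abs_nonneg _) (hfj i z) 2
      calc (∑ i : Fin 3, fderiv ℝ f z (EuclideanSpace.single i (1:ℝ)) ^ 2) ≤ ∑ _i : Fin 3, M ^ 2 :=
            Finset.sum_le_sum fun i _ => this i
        _ = 3 * M ^ 2 := by simp
    rw [abs_div, abs_of_pos hJ, abs_of_nonneg (Finset.sum_nonneg fun i _ => sq_nonneg _), div_le_iff₀ hJ]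
    nlinarith
  have I01 : IntegrableOn (fun z => (∑ i : Fin 3, ‖G z (EuclideanSpace.single i (1:ℝ))‖ ^ 2) +
      t * (∑ i : Fin 3, 2 * fderiv ℝ f z (EuclideanSpace.single i (1:ℝ)) *
          ⟪G z (EuclideanSpace.single i (1:ℝ)), G z (EuclideanSpace.single k (1:ℝ))⟫ -
        fderiv ℝ f z (EuclideanSpace.single k (1:ℝ)) * ∑ i : Fin 3, ‖G z (EuclideanSpace.single i (1:ℝ))‖ ^ 2))
      (ball y ρ) volume := hGiB.add (II₁.const_mul t)
  have I2 : IntegrableOn (fun z => t ^ 2 * ((∑ i : Fin 3, fderiv ℝ f z (EuclideanSpace.single i (1:ℝ)) ^ 2) /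
        (1 - t * fderiv ℝ f z (EuclideanSpace.single k (1:ℝ))) * ‖G z (EuclideanSpace.single k (1:ℝ))‖ ^ 2))
      (ball y ρ) volume := IR.const_mul (t ^ 2)
  rw [integral_add I01 I2, integral_add hGiB (II₁.const_mul t), integral_const_mul, integral_const_mul] at hminW
  -- `0 ≤ t I₁ + t² r(t)` with `r(t) ≤ C`
  have hr : ∫ z in ball y ρ, (∑ i : Fin 3, fderiv ℝ f z (EuclideanSpace.single i (1:ℝ)) ^ 2) /
        (1 - t * fderiv ℝ f z (EuclideanSpace.single k (1:ℝ))) * ‖G z (EuclideanSpace.single k (1:ℝ))‖ ^ 2 ≤ C := by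
    rw [hC, ← integral_const_mul]
    refine setIntegral_mono_on IR ((Isq k).const_mul _) hBm fun z _ => ?_
    have hJ := hJpos z
    have hJ2 : 1 / 2 ≤ 1 - t * fderiv ℝ f z (EuclideanSpace.single k (1:ℝ)) := by
      have h1 : |t * fderiv ℝ f z (EuclideanSpace.single k (1:ℝ))| ≤ 1 / 2 := by
        rw [abs_mul]; exact (mul_le_mul_of_nonneg_left (hfj k z) (abs_nonneg t)).trans htM
      linarith [(abs_le.mp h1).2]
    have hnum : (∑ i : Fin 3, fderiv ℝ f z (EuclideanSpace.single i (1:ℝ)) ^ 2) ≤ 3 * M ^ 2 := by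
      have : ∀ i : Fin 3, fderiv ℝ f z (EuclideanSpace.single i (1:ℝ)) ^ 2 ≤ M ^ 2 := fun i => by
        rw [← sq_abs]; exact pow_le_pow_left₀ (abs_nonneg _) (hfj i z) 2
      calc (∑ i : Fin 3, fderiv ℝ f z (EuclideanSpace.single i (1:ℝ)) ^ 2) ≤ ∑ _i : Fin 3, M ^ 2 :=
            Finset.sum_le_sum fun i _ => this i
        _ = 3 * M ^ 2 := by simp
    refine mul_le_mul_of_nonneg_right ?_ (sq_nonneg _)
    rw [div_le_iff₀ hJ]
    nlinarith
  nlinarith [hminW, hr, sq_nonneg t]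

end Summit.QuantumFields.YangMills.Theorems.PoincareLipschitzAxialStationarity

end
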